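import Summits.QuantumFields.YangMills.Theorems.ColdStartUniversalityLatticeLangevinLiebRobinsonSecondDerivative
import Summits.QuantumFields.YangMills.Theorems.ColdStartUniversalityLatticeLangevinLiebRobinsonStrongCouplingSlope
import HarnessLib

/-!
# Route `ColdStartUniversality` (fixed-cut-off SZZ dynamics; LIEB–ROBINSON / LOCALITY package, file 33):
# ★★★ SECOND-ORDER STRONG-COUPLING EXPANSION WITH A VOLUME-UNIFORM REMAINDER: `⟨Re tr U_p⟩_b = b + O(b²)` FOR EVERY `L ≥ 2`

Helper file (seat `ym-line-csu-p1`, g31; `--supports stmt-QuantumFields-24809`).  For the `SU(2)` Wilson measure `μ_b` on `(ℤ/L)³` and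
`|b| ≤ |β₀| < 1/12`:
* ★★★ `wilson_loop_expectation_taylor_two` — for every non-empty loop word `w`:
  `|⟨Re tr w⟩_(μ_b) − ⟨Re tr w⟩_(μ_0) − b·(d/db|_0 ⟨Re tr w⟩)| ≤ K₀(|w|, β₀)·b²` with `K₀ = 27·4096π²(|w|²+8)(2/ρ₀)·108·|w|²·((1+24/κ₀)³/(1−e^(−κ₀/4)))²`,
  `ρ₀ = 1 − 12|β₀|`, `κ₀ = ρ₀ log 108/(2((1300+4√2)|β₀| + ρ₀))` — a constant INDEPENDENT OF `L` (mean value inequality twice, with the volume-uniform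
  bound on the second derivative of file 32 and the monotonicity `threePointConstant_mono` of the constants on the window);
* ★★★ `plaquette_expectation_taylor_two` — for `1 < L` and every plaquette `p`: **`|⟨Re tr U_p⟩_(μ_b) − b| ≤ K₀(4, β₀)·b²`**: the strong-coupling
  expansion of the plaquette to second order, `⟨Re tr U_p⟩_b = b + O(b²)`, with an error term uniform in the volume (files 26, 28, 32).
THEOREMS ONLY, no definition, no sorry; [folklore; cite: Wilson1974, §III].  HONEST FRAMING: fixed cut-off, strong-coupling window, astronomically
large constant; nothing about `β'_K → ∞`; `UniformColdStartMixing` (24809) is NOT restated; no crux, rung or summit statement is proved; the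
Yang–Mills mass gap is NOT proved.
-/

set_option autoImplicit false

noncomputable section

namespace Summit.QuantumFields.YangMills.Theorems.ColdStartUniversality.LiebRobinson

open MeasureTheory ProbabilityTheory Matrix Complex Finset Filter Set Metric Function
open scoped ComplexConjugate BigOperators Matrix NNReal ENNReal Topology
open Literature.Probability.Process Literature.MathematicalPhysics.QuantumFieldTheory
open Literature.MathematicalPhysics.QuantumFieldTheory.Balaban1983to89
open Literature.MathematicalPhysics.QuantumLattice (fundamentalRep fundamentalLatticeRep continuous_fundamentalRep fundamentalRep_apply)

variable {L : ℕ} [NeZero L]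

omit [NeZero L] in
/-- **Monotonicity of the second-order constant on the window**: for `|x| ≤ |β₀| < 1/12`, `K(x) ≤ K₀(β₀)` (`ρ` decreases, `κ` decreases and
`e^(2κ) ≤ 108` along `|x| ↑`). [folklore] -/
theorem threePointConstant_mono {x β₀ c : ℝ} (hx : |x| ≤ |β₀|) (hβ₀ : |β₀| < 1 / 12) (hc : 0 ≤ c) :
    (27 * (4096 * Real.pi ^ 2 * (c + 8) * (2 / (1 - 12 * |x|)) * Real.exp (2 * ((1 - 12 * |x|) * Real.log 108 / (2 * ((1300 + 4 * Real.sqrt 2) * |x| + (1 - 12 * |x|)))))) * c * ((1 + 12 / (((1 - 12 * |x|) * Real.log 108 / (2 * ((1300 + 4 * Real.sqrt 2) * |x| + (1 - 12 * |x|)))) / 2)) ^ 3 / (1 - Real.exp (-((((1 - 12 * |x|) * Real.log 108 / (2 * ((1300 + 4 * Real.sqrt 2) * |x| + (1 - 12 * |x|)))) / 2) / 2)))) ^ 2) ≤ (27 * (4096 * Real.pi ^ 2 * (c + 8) * (2 / (1 - 12 * |β₀|)) * 108) * c * ((1 + 12 / (((1 - 12 * |β₀|) * Real.log 108 / (2 *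 ((1300 + 4 * Real.sqrt 2) * |β₀| + (1 - 12 * |β₀|)))) / 2)) ^ 3 / (1 - Real.exp (-((((1 - 12 * |β₀|) * Real.log 108 / (2 * ((1300 + 4 * Real.sqrt 2) * |β₀| + (1 - 12 * |β₀|)))) / 2) / 2)))) ^ 2) := by
  have hlog : 0 < Real.log 108 := Real.log_pos (by norm_num)
  have hax : 0 ≤ |x| := abs_nonneg x
  have hρ0 : 0 < (1 - 12 * |β₀|) := by linarith
  have hρx : (1 - 12 * |β₀|) ≤ (1 - 12 * |x|) := by linarith
  have hρx0 : 0 < (1 - 12 * |x|) := by linarith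
  have hl0 : 0 ≤ (1300 + 4 * Real.sqrt 2) * |x| := by positivity
  have hlx : (1300 + 4 * Real.sqrt 2) * |x| ≤ (1300 + 4 * Real.sqrt 2) * |β₀| :=
    mul_le_mul_of_nonneg_left hx (by positivity)
  have hden0 : 0 < (1300 + 4 * Real.sqrt 2) * |β₀| + (1 - 12 * |β₀|) := by linarith
  have hdenx : 0 < (1300 + 4 * Real.sqrt 2) * |x| + (1 - 12 * |x|) := by linarith
  have hκ0 : 0 < ((1 - 12 * |β₀|) * Real.log 108 / (2 * ((1300 + 4 * Real.sqrt 2) * |β₀| + (1 - 12 * |β₀|)))) := by positivity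
  have hκx0 : 0 < ((1 - 12 * |x|) * Real.log 108 / (2 * ((1300 + 4 * Real.sqrt 2) * |x| + (1 - 12 * |x|)))) := by positivity
  have hκ : ((1 - 12 * |β₀|) * Real.log 108 / (2 * ((1300 + 4 * Real.sqrt 2) * |β₀| + (1 - 12 * |β₀|)))) ≤ ((1 - 12 * |x|) * Real.log 108 / (2 * ((1300 + 4 * Real.sqrt 2) * |x| + (1 - 12 * |x|)))) := by
    rw [div_le_div_iff₀ (by positivity) (by positivity)]
    have h1 : (1 - 12 * |β₀|) * (1300 + 4 * Real.sqrt 2) * |x| ≤ (1 - 12 * |x|) * (1300 + 4 * Real.sqrt 2) * |β₀| := by nlinarith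
    nlinarith
  have hκle : ((1 - 12 * |x|) * Real.log 108 / (2 * ((1300 + 4 * Real.sqrt 2) * |x| + (1 - 12 * |x|)))) ≤ Real.log 108 / 2 := by
    rw [div_le_div_iff₀ (by positivity) (by norm_num)]
    nlinarith
  have h1 : 2 / (1 - 12 * |x|) ≤ 2 / (1 - 12 * |β₀|) := div_le_div_of_nonneg_left (by norm_num) hρ0 hρx
  have h2 : Real.exp (2 * ((1 - 12 * |x|) * Real.log 108 / (2 * ((1300 + 4 * Real.sqrt 2) * |x| + (1 - 12 * |x|))))) ≤ 108 := by
    have h : Real.exp (2 * ((1 - 12 * |x|) * Real.log 108 / (2 * ((1300 + 4 * Real.sqrt 2) * |x| + (1 - 12 * |x|))))) ≤ Real.exp (Real.log 108) := Real.exp_le_exp.2 (by linarith)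
    rwa [Real.exp_log (by norm_num : (0 : ℝ) < 108)] at h
  have h3 : (1 + 12 / (((1 - 12 * |x|) * Real.log 108 / (2 * ((1300 + 4 * Real.sqrt 2) * |x| + (1 - 12 * |x|)))) / 2)) ^ 3 ≤ (1 + 12 / (((1 - 12 * |β₀|) * Real.log 108 / (2 * ((1300 + 4 * Real.sqrt 2) * |β₀| + (1 - 12 * |β₀|)))) / 2)) ^ 3 := by
    have : 12 / (((1 - 12 * |x|) * Real.log 108 / (2 * ((1300 + 4 * Real.sqrt 2) * |x| + (1 - 12 * |x|)))) / 2) ≤ 12 / (((1 - 12 * |β₀|) * Real.log 108 / (2 * ((1300 + 4 * Real.sqrt 2) * |β₀| + (1 - 12 * |β₀|)))) / 2) := div_le_div_of_nonneg_left (by norm_num) (by positivity) (by linarith)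
    exact pow_le_pow_left₀ (by positivity) (by linarith) 3
  have hq0 : 0 < 1 - Real.exp (-((((1 - 12 * |β₀|) * Real.log 108 / (2 * ((1300 + 4 * Real.sqrt 2) * |β₀| + (1 - 12 * |β₀|)))) / 2) / 2)) := by
    have := Real.exp_lt_one_iff.2 (show -((((1 - 12 * |β₀|) * Real.log 108 / (2 * ((1300 + 4 * Real.sqrt 2) * |β₀| + (1 - 12 * |β₀|)))) / 2) / 2) < 0 by linarith); linarith
  have h4 : 1 - Real.exp (-((((1 - 12 * |β₀|) * Real.log 108 / (2 * ((1300 + 4 * Real.sqrt 2) * |β₀| + (1 - 12 * |β₀|)))) / 2) / 2)) ≤ 1 - Real.exp (-((((1 - 12 * |x|) * Real.log 108 / (2 * ((1300 + 4 * Real.sqrt 2) * |x| + (1 - 12 * |x|)))) / 2) / 2)) := by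
    have := Real.exp_le_exp.2 (show -((((1 - 12 * |x|) * Real.log 108 / (2 * ((1300 + 4 * Real.sqrt 2) * |x| + (1 - 12 * |x|)))) / 2) / 2) ≤ -((((1 - 12 * |β₀|) * Real.log 108 / (2 * ((1300 + 4 * Real.sqrt 2) * |β₀| + (1 - 12 * |β₀|)))) / 2) / 2) by linarith); linarith
  have h5 : ((1 + 12 / (((1 - 12 * |x|) * Real.log 108 / (2 * ((1300 + 4 * Real.sqrt 2) * |x| + (1 - 12 * |x|)))) / 2)) ^ 3 / (1 - Real.exp (-((((1 - 12 * |x|) * Real.log 108 / (2 * ((1300 + 4 * Real.sqrt 2) * |x| + (1 - 12 * |x|)))) / 2) / 2)))) ≤ ((1 + 12 / (((1 - 12 * |β₀|) * Real.log 108 / (2 * ((1300 + 4 * Real.sqrt 2) * |β₀| + (1 - 12 * |β₀|)))) / 2)) ^ 3 / (1 - Real.exp (-((((1 - 12 * |β₀|) * Real.log 108 / (2 * ((1300 + 4 * Real.sqrt 2) * |β₀| + (1 - 12 * |β₀|)))) / 2) / 2)))) := div_le_div₀ (by positivity) h3 hq0 h4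
  have hG0 : 0 ≤ ((1 + 12 / (((1 - 12 * |x|) * Real.log 108 / (2 * ((1300 + 4 * Real.sqrt 2) * |x| + (1 - 12 * |x|)))) / 2)) ^ 3 / (1 - Real.exp (-((((1 - 12 * |x|) * Real.log 108 / (2 * ((1300 + 4 * Real.sqrt 2) * |x| + (1 - 12 * |x|)))) / 2) / 2)))) := div_nonneg (by positivity) (hq0.le.trans h4)
  have h6 : ((1 + 12 / (((1 - 12 * |x|) * Real.log 108 / (2 * ((1300 + 4 * Real.sqrt 2) * |x| + (1 - 12 * |x|)))) / 2)) ^ 3 / (1 - Real.exp (-((((1 - 12 * |x|) * Real.log 108 / (2 * ((1300 + 4 * Real.sqrt 2) * |x| + (1 - 12 * |x|)))) / 2) / 2)))) ^ 2 ≤ ((1 + 12 / (((1 - 12 * |β₀|) * Real.log 108 / (2 * ((1300 + 4 * Real.sqrt 2) * |β₀| + (1 - 12 * |β₀|)))) / 2)) ^ 3 / (1 - Real.exp (-((((1 - 12 * |β₀|) * Real.log 108 / (2 * ((1300 + 4 * Real.sqrt 2) * |β₀| + (1 - 12 * |β₀|)))) / 2) / 2)))) ^ 2 := pow_le_pow_left₀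 hG0 h5 2
  have h7 : 4096 * Real.pi ^ 2 * (c + 8) * (2 / (1 - 12 * |x|)) * Real.exp (2 * ((1 - 12 * |x|) * Real.log 108 / (2 * ((1300 + 4 * Real.sqrt 2) * |x| + (1 - 12 * |x|))))) ≤ 4096 * Real.pi ^ 2 * (c + 8) * (2 / (1 - 12 * |β₀|)) * 108 :=
    mul_le_mul (mul_le_mul_of_nonneg_left h1 (by positivity)) h2 (Real.exp_pos _).le (by positivity)
  have h8 : 27 * (4096 * Real.pi ^ 2 * (c + 8) * (2 / (1 - 12 * |x|)) * Real.exp (2 * ((1 - 12 * |x|) * Real.log 108 / (2 * ((1300 + 4 * Real.sqrt 2) * |x| + (1 - 12 * |x|)))))) * c ≤ 27 * (4096 * Real.pi ^ 2 * (c + 8) * (2 / (1 - 12 * |β₀|)) * 108) * c :=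
    mul_le_mul_of_nonneg_right (mul_le_mul_of_nonneg_left h7 (by norm_num)) hc
  exact mul_le_mul h8 h6 (by positivity) (by positivity)

/-- ★★★ **SECOND-ORDER EXPANSION IN THE COUPLING WITH A VOLUME-UNIFORM REMAINDER.**  For `|β₀| < 1/12`, every `L`, every non-empty loop word `w`
and every `b ∈ [−|β₀|, |β₀|]`:
`|⟨Re tr w⟩_(μ_b) − ⟨Re tr w⟩_(μ_0) − b·(−Cov_(μ_0)(Re tr w, S_W))| ≤ 27·4096π²(|w|²+8)(2/ρ₀)·108·|w|²·((1+24/κ₀)³/(1−e^(−κ₀/4)))²·b²`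
— the constant does not depend on `L` (`hasDerivAt_wilson_loop_expectation`, `hasDerivAt_wilson_loop_covariance`, `abs_sum_sum_threePoint_le`, mean
value inequality twice).  Fixed cut-off; the Yang–Mills mass gap is NOT proved. [folklore; cite: Wilson1974, §III] -/
theorem wilson_loop_expectation_taylor_two (L : ℕ) [NeZero L] (β₀ : ℝ) (hβ₀ : |β₀| < 1 / 12) (l₁ : List (Edge 3 L × Bool)) (hl₁ : l₁ ≠ [])
    {b : ℝ} (hb : b ∈ Set.Icc (-|β₀|) |β₀|) :
    let coords : GaugeConfig 3 L (Matrix.specialUnitaryGroup (Fin 2) ℂ) → (Edge 3 L × Fin 2 × Fin 2 × Bool → ℝ) :=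
      fun V q => (fun z : ℂ => if q.2.2.2 then z.im else z.re)
        ((fundamentalRep (Fin 2) (V q.1) : Matrix (Fin 2) (Fin 2) ℂ) q.2.1 q.2.2.1)
    |(∫ x, (fun y : (Edge 3 L × Fin 2 × Fin 2 × Bool → ℝ) => ((l₁.map (fun a : Edge 3 L × Bool => if a.2 then ((fun (ee : Edge 3 L) => Matrix.of fun (i j : Fin 2) => ((y (ee, i, j, false) : ℝ) : ℂ) + ((y (ee, i, j, true) : ℝ) : ℂ) * Complex.I) a.1)ᴴ else (fun (ee : Edge 3 L) => Matrix.of fun (i j : Fin 2) => ((y (ee, i, j, false) : ℝ) : ℂ) + ((y (ee, i, j, true) : ℝ) : ℂ) * Complex.I) a.1)).prod).trace.re) (coords x) ∂(wilsonMeasure (d := 3) (L := L) (fundamentalRep (Fin 2)) b)) - (∫ x, (fun y : (Edge 3 L × Fin 2 × Fin 2 × Bool → ℝ) => ((l₁.map (fun a : Edge 3 L × Bool => if a.2 then ((fun (ee : Edge 3 L) => Matrix.of fun (i j : Fin 2) => ((y (ee, i, j, false) : ℝ) : ℂ) + ((y (ee, i, j, true) : ℝ) : ℂ) * Complex.I)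 a.1)ᴴ else (fun (ee : Edge 3 L) => Matrix.of fun (i j : Fin 2) => ((y (ee, i, j, false) : ℝ) : ℂ) + ((y (ee, i, j, true) : ℝ) : ℂ) * Complex.I) a.1)).prod).trace.re) (coords x) ∂(wilsonMeasure (d := 3) (L := L) (fundamentalRep (Fin 2)) 0)) - b * (-((∫ x, (fun y : (Edge 3 L × Fin 2 × Fin 2 × Bool → ℝ) => ((l₁.map (fun a : Edge 3 L × Bool => if a.2 then ((fun (ee : Edge 3 L) => Matrix.of fun (i j : Fin 2) => ((y (ee, i, j, false) : ℝ) : ℂ) + ((y (ee, i, j, true) : ℝ) : ℂ) * Complex.I) a.1)ᴴ else (fun (ee : Edge 3 L) => Matrix.of fun (i j : Fin 2) => ((y (ee, i, j, false) : ℝ) : ℂ) + ((y (ee, i, j, true) : ℝ) : ℂ) * Complex.I) a.1)).prod).trace.re) (coords x) * Literature.MathematicalPhysics.QuantumFieldTheory.wilsonAction (fundamentalRep (Fin 2)) x ∂(wilsonMeasure (d := 3) (L := L) (fundamentalRep (Fin 2)) 0)) - (∫ x, (fun y : (Edge 3 L × Fin 2 × Fin 2 × Bool → ℝ) => ((l₁.map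 (fun a : Edge 3 L × Bool => if a.2 then ((fun (ee : Edge 3 L) => Matrix.of fun (i j : Fin 2) => ((y (ee, i, j, false) : ℝ) : ℂ) + ((y (ee, i, j, true) : ℝ) : ℂ) * Complex.I) a.1)ᴴ else (fun (ee : Edge 3 L) => Matrix.of fun (i j : Fin 2) => ((y (ee, i, j, false) : ℝ) : ℂ) + ((y (ee, i, j, true) : ℝ) : ℂ) * Complex.I) a.1)).prod).trace.re) (coords x) ∂(wilsonMeasure (d := 3) (L := L) (fundamentalRep (Fin 2)) 0)) * (∫ x, Literature.MathematicalPhysics.QuantumFieldTheory.wilsonAction (fundamentalRep (Fin 2)) x ∂(wilsonMeasure (d := 3) (L := L) (fundamentalRep (Fin 2)) 0))))| ≤ (27 * (4096 * Real.pi ^ 2 * ((l₁.length : ℝ) ^ 2 + 8) * (2 / (1 - 12 * |β₀|)) * 108) * (l₁.length : ℝ) ^ 2 * ((1 + 12 / (((1 - 12 * |β₀|) * Real.log 108 / (2 * ((1300 + 4 * Real.sqrt 2) * |β₀| + (1 - 12 * |β₀|)))) / 2)) ^ 3 / (1 - Real.exp (-((((1 - 12 * |β₀|) * Real.log 108 /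 (2 * ((1300 + 4 * Real.sqrt 2) * |β₀| + (1 - 12 * |β₀|)))) / 2) / 2)))) ^ 2) * b ^ 2 := by
  intro coords
  have hK0 : 0 ≤ (27 * (4096 * Real.pi ^ 2 * ((l₁.length : ℝ) ^ 2 + 8) * (2 / (1 - 12 * |β₀|)) * 108) * (l₁.length : ℝ) ^ 2 * ((1 + 12 / (((1 - 12 * |β₀|) * Real.log 108 / (2 * ((1300 + 4 * Real.sqrt 2) * |β₀| + (1 - 12 * |β₀|)))) / 2)) ^ 3 / (1 - Real.exp (-((((1 - 12 * |β₀|) * Real.log 108 / (2 * ((1300 + 4 * Real.sqrt 2) * |β₀| + (1 - 12 * |β₀|)))) / 2) / 2)))) ^ 2) := by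
    have hρ0 : 0 < (1 - 12 * |β₀|) := by linarith
    positivity
  -- the first derivative `g` and its derivative bound on the window
  have hg : ∀ t ∈ Set.Icc (-|β₀|) |β₀|, HasDerivWithinAt (fun t : ℝ => (-((∫ x, (fun y : (Edge 3 L × Fin 2 × Fin 2 × Bool → ℝ) => ((l₁.map (fun a : Edge 3 L × Bool => if a.2 then ((fun (ee : Edge 3 L) => Matrix.of fun (i j : Fin 2) => ((y (ee, i, j, false) : ℝ) : ℂ) + ((y (ee, i, j, true) : ℝ) : ℂ) * Complex.I) a.1)ᴴ else (fun (ee : Edge 3 L) => Matrix.of fun (i j : Fin 2) => ((y (ee, i, j, false) : ℝ) : ℂ) + ((y (ee, i, j, true) : ℝ) : ℂ) * Complex.I) a.1)).prod).trace.re) (coords x) * Literature.MathematicalPhysics.QuantumFieldTheory.wilsonAction (fundamentalRep (Fin 2)) x ∂(wilsonMeasure (d := 3) (L := L) (fundamentalRep (Fin 2)) t)) - (∫ x, (fun y : (Edge 3 L × Fin 2 × Fin 2 × Bool → ℝ) => ((l₁.map (fun a : Edge 3 L × Bool => if a.2 then ((fun (ee : Edge 3 L) => Matrix.of fun (i j :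 Fin 2) => ((y (ee, i, j, false) : ℝ) : ℂ) + ((y (ee, i, j, true) : ℝ) : ℂ) * Complex.I) a.1)ᴴ else (fun (ee : Edge 3 L) => Matrix.of fun (i j : Fin 2) => ((y (ee, i, j, false) : ℝ) : ℂ) + ((y (ee, i, j, true) : ℝ) : ℂ) * Complex.I) a.1)).prod).trace.re) (coords x) ∂(wilsonMeasure (d := 3) (L := L) (fundamentalRep (Fin 2)) t)) * (∫ x, Literature.MathematicalPhysics.QuantumFieldTheory.wilsonAction (fundamentalRep (Fin 2)) x ∂(wilsonMeasure (d := 3) (L := L) (fundamentalRep (Fin 2)) t)))))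
      (∑ q : Plaquette 3 L, ∑ q' : Plaquette 3 L, ∫ x, ((fun y : (Edge 3 L × Fin 2 × Fin 2 × Bool → ℝ) => ((l₁.map (fun a : Edge 3 L × Bool => if a.2 then ((fun (ee : Edge 3 L) => Matrix.of fun (i j : Fin 2) => ((y (ee, i, j, false) : ℝ) : ℂ) + ((y (ee, i, j, true) : ℝ) : ℂ) * Complex.I) a.1)ᴴ else (fun (ee : Edge 3 L) => Matrix.of fun (i j : Fin 2) => ((y (ee, i, j, false) : ℝ) : ℂ) + ((y (ee, i, j, true) : ℝ) : ℂ) * Complex.I) a.1)).prod).trace.re) (coords x) - ∫ x, (fun y : (Edge 3 L × Fin 2 × Fin 2 × Bool → ℝ) => ((l₁.map (fun a : Edge 3 L × Bool => if a.2 then ((fun (ee : Edge 3 L) => Matrix.of fun (i j : Fin 2) => ((y (ee, i, j, false) : ℝ) : ℂ) + ((y (ee, i, j, true) : ℝ) : ℂ) * Complex.I) a.1)ᴴ else (fun (ee : Edge 3 L) => Matrix.of fun (i j : Fin 2) => ((y (ee, i, j, false) : ℝ) : ℂ) + ((y (ee, i, j, true) : ℝ) : ℂ) * Complex.I) a.1)).prod).trace.re)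 (coords x) ∂(wilsonMeasure (d := 3) (L := L) (fundamentalRep (Fin 2)) t)) * ((fun y : (Edge 3 L × Fin 2 × Fin 2 × Bool → ℝ) => (([((q.1, q.2.1.1), false), ((Literature.MathematicalPhysics.QuantumFieldTheory.Site.shift q.1 q.2.1.1, q.2.1.2), false), ((Literature.MathematicalPhysics.QuantumFieldTheory.Site.shift q.1 q.2.1.2, q.2.1.1), true), ((q.1, q.2.1.2), true)].map (fun a : Edge 3 L × Bool => if a.2 then ((fun (ee : Edge 3 L) => Matrix.of fun (i j : Fin 2) => ((y (ee, i, j, false) : ℝ) : ℂ) + ((y (ee, i, j, true) : ℝ) : ℂ) * Complex.I) a.1)ᴴ else (fun (ee : Edge 3 L) => Matrix.of fun (i j : Fin 2) => ((y (ee, i, j, false) : ℝ) : ℂ) + ((y (ee, i, j, true) : ℝ) : ℂ) * Complex.I) a.1)).prod).trace.re) (coords x) - ∫ x, (fun y : (Edge 3 L × Fin 2 × Fin 2 × Bool → ℝ) => (([((q.1, q.2.1.1), false), ((Literature.MathematicalPhysics.QuantumFieldTheory.Site.shift q.1 q.2.1.1, q.2.1.2), false), ((Literature.MathematicalPhysics.QuantumFieldTheory.Site.shift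 q.1 q.2.1.2, q.2.1.1), true), ((q.1, q.2.1.2), true)].map (fun a : Edge 3 L × Bool => if a.2 then ((fun (ee : Edge 3 L) => Matrix.of fun (i j : Fin 2) => ((y (ee, i, j, false) : ℝ) : ℂ) + ((y (ee, i, j, true) : ℝ) : ℂ) * Complex.I) a.1)ᴴ else (fun (ee : Edge 3 L) => Matrix.of fun (i j : Fin 2) => ((y (ee, i, j, false) : ℝ) : ℂ) + ((y (ee, i, j, true) : ℝ) : ℂ) * Complex.I) a.1)).prod).trace.re) (coords x) ∂(wilsonMeasure (d := 3) (L := L) (fundamentalRep (Fin 2)) t)) * ((fun y : (Edge 3 L × Fin 2 × Fin 2 × Bool → ℝ) => (([((q'.1, q'.2.1.1), false), ((Literature.MathematicalPhysics.QuantumFieldTheory.Site.shift q'.1 q'.2.1.1, q'.2.1.2), false), ((Literature.MathematicalPhysics.QuantumFieldTheory.Site.shift q'.1 q'.2.1.2, q'.2.1.1), true), ((q'.1, q'.2.1.2), true)].map (fun a : Edge 3 L × Bool => if a.2 then ((fun (ee : Edge 3 L) => Matrix.of fun (i j : Fin 2) => ((y (ee, i, j, false) : ℝ) : ℂ) + ((y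 (ee, i, j, true) : ℝ) : ℂ) * Complex.I) a.1)ᴴ else (fun (ee : Edge 3 L) => Matrix.of fun (i j : Fin 2) => ((y (ee, i, j, false) : ℝ) : ℂ) + ((y (ee, i, j, true) : ℝ) : ℂ) * Complex.I) a.1)).prod).trace.re) (coords x) - ∫ x, (fun y : (Edge 3 L × Fin 2 × Fin 2 × Bool → ℝ) => (([((q'.1, q'.2.1.1), false), ((Literature.MathematicalPhysics.QuantumFieldTheory.Site.shift q'.1 q'.2.1.1, q'.2.1.2), false), ((Literature.MathematicalPhysics.QuantumFieldTheory.Site.shift q'.1 q'.2.1.2, q'.2.1.1), true), ((q'.1, q'.2.1.2), true)].map (fun a : Edge 3 L × Bool => if a.2 then ((fun (ee : Edge 3 L) => Matrix.of fun (i j : Fin 2) => ((y (ee, i, j, false) : ℝ) : ℂ) + ((y (ee, i, j, true) : ℝ) : ℂ) * Complex.I) a.1)ᴴ else (fun (ee : Edge 3 L) => Matrix.of fun (i j : Fin 2) => ((y (ee, i, j, false) : ℝ) : ℂ) + ((y (ee, i, j, true) : ℝ) : ℂ) * Complex.I) a.1)).prod).trace.re) (coords x) ∂(wilsonMeasure (d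 := 3) (L := L) (fundamentalRep (Fin 2)) t)) ∂(wilsonMeasure (d := 3) (L := L) (fundamentalRep (Fin 2)) t)) (Set.Icc (-|β₀|) |β₀|) t :=
    fun t _ => (hasDerivAt_wilson_loop_covariance L t l₁).hasDerivWithinAt
  have hgb : ∀ t ∈ Set.Icc (-|β₀|) |β₀|, ‖∑ q : Plaquette 3 L, ∑ q' : Plaquette 3 L, ∫ x, ((fun y : (Edge 3 L × Fin 2 × Fin 2 × Bool → ℝ) => ((l₁.map (fun a : Edge 3 L × Bool => if a.2 then ((fun (ee : Edge 3 L) => Matrix.of fun (i j : Fin 2) => ((y (ee, i, j, false) : ℝ) : ℂ) + ((y (ee, i, j, true) : ℝ) : ℂ) * Complex.I) a.1)ᴴ else (fun (ee : Edge 3 L) => Matrix.of fun (i j : Fin 2) => ((y (ee, i, j, false) : ℝ) : ℂ) + ((y (ee, i, j, true) : ℝ) : ℂ) * Complex.I) a.1)).prod).trace.re) (coords x) - ∫ x, (fun y : (Edge 3 L × Fin 2 × Fin 2 × Bool → ℝ) => ((l₁.map (fun a : Edge 3 L × Bool => if a.2 then ((fun (ee : Edge 3 L) => Matrix.of fun (i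 j : Fin 2) => ((y (ee, i, j, false) : ℝ) : ℂ) + ((y (ee, i, j, true) : ℝ) : ℂ) * Complex.I) a.1)ᴴ else (fun (ee : Edge 3 L) => Matrix.of fun (i j : Fin 2) => ((y (ee, i, j, false) : ℝ) : ℂ) + ((y (ee, i, j, true) : ℝ) : ℂ) * Complex.I) a.1)).prod).trace.re) (coords x) ∂(wilsonMeasure (d := 3) (L := L) (fundamentalRep (Fin 2)) t)) * ((fun y : (Edge 3 L × Fin 2 × Fin 2 × Bool → ℝ) => (([((q.1, q.2.1.1), false), ((Literature.MathematicalPhysics.QuantumFieldTheory.Site.shift q.1 q.2.1.1, q.2.1.2), false), ((Literature.MathematicalPhysics.QuantumFieldTheory.Site.shift q.1 q.2.1.2, q.2.1.1), true), ((q.1, q.2.1.2), true)].map (fun a : Edge 3 L × Bool => if a.2 then ((fun (ee : Edge 3 L) => Matrix.of fun (i j : Fin 2) => ((y (ee, i, j, false) : ℝ) : ℂ) + ((y (ee, i, j, true) : ℝ) : ℂ) * Complex.I) a.1)ᴴ else (fun (ee : Edge 3 L) => Matrix.of fun (i j : Fin 2) => ((y (ee, i, j, false) : ℝ) : ℂ)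 + ((y (ee, i, j, true) : ℝ) : ℂ) * Complex.I) a.1)).prod).trace.re) (coords x) - ∫ x, (fun y : (Edge 3 L × Fin 2 × Fin 2 × Bool → ℝ) => (([((q.1, q.2.1.1), false), ((Literature.MathematicalPhysics.QuantumFieldTheory.Site.shift q.1 q.2.1.1, q.2.1.2), false), ((Literature.MathematicalPhysics.QuantumFieldTheory.Site.shift q.1 q.2.1.2, q.2.1.1), true), ((q.1, q.2.1.2), true)].map (fun a : Edge 3 L × Bool => if a.2 then ((fun (ee : Edge 3 L) => Matrix.of fun (i j : Fin 2) => ((y (ee, i, j, false) : ℝ) : ℂ) + ((y (ee, i, j, true) : ℝ) : ℂ) * Complex.I) a.1)ᴴ else (fun (ee : Edge 3 L) => Matrix.of fun (i j : Fin 2) => ((y (ee, i, j, false) : ℝ) : ℂ) + ((y (ee, i, j, true) : ℝ) : ℂ) * Complex.I) a.1)).prod).trace.re) (coords x) ∂(wilsonMeasure (d := 3) (L := L) (fundamentalRep (Fin 2)) t)) * ((fun y : (Edge 3 L × Fin 2 × Fin 2 × Bool → ℝ) => (([((q'.1, q'.2.1.1), false), ((Literature.MathematicalPhysics.QuantumFieldTheory.Site.shift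 q'.1 q'.2.1.1, q'.2.1.2), false), ((Literature.MathematicalPhysics.QuantumFieldTheory.Site.shift q'.1 q'.2.1.2, q'.2.1.1), true), ((q'.1, q'.2.1.2), true)].map (fun a : Edge 3 L × Bool => if a.2 then ((fun (ee : Edge 3 L) => Matrix.of fun (i j : Fin 2) => ((y (ee, i, j, false) : ℝ) : ℂ) + ((y (ee, i, j, true) : ℝ) : ℂ) * Complex.I) a.1)ᴴ else (fun (ee : Edge 3 L) => Matrix.of fun (i j : Fin 2) => ((y (ee, i, j, false) : ℝ) : ℂ) + ((y (ee, i, j, true) : ℝ) : ℂ) * Complex.I) a.1)).prod).trace.re) (coords x) - ∫ x, (fun y : (Edge 3 L × Fin 2 × Fin 2 × Bool → ℝ) => (([((q'.1, q'.2.1.1), false), ((Literature.MathematicalPhysics.QuantumFieldTheory.Site.shift q'.1 q'.2.1.1, q'.2.1.2), false), ((Literature.MathematicalPhysics.QuantumFieldTheory.Site.shift q'.1 q'.2.1.2, q'.2.1.1), true), ((q'.1, q'.2.1.2), true)].map (fun a : Edge 3 L × Bool => if a.2 then ((fun (ee : Edge 3 L) => Matrix.of fun (i j : Fin 2) => ((y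 (ee, i, j, false) : ℝ) : ℂ) + ((y (ee, i, j, true) : ℝ) : ℂ) * Complex.I) a.1)ᴴ else (fun (ee : Edge 3 L) => Matrix.of fun (i j : Fin 2) => ((y (ee, i, j, false) : ℝ) : ℂ) + ((y (ee, i, j, true) : ℝ) : ℂ) * Complex.I) a.1)).prod).trace.re) (coords x) ∂(wilsonMeasure (d := 3) (L := L) (fundamentalRep (Fin 2)) t)) ∂(wilsonMeasure (d := 3) (L := L) (fundamentalRep (Fin 2)) t)‖ ≤ (27 * (4096 * Real.pi ^ 2 * ((l₁.length : ℝ) ^ 2 + 8) * (2 / (1 - 12 * |β₀|)) * 108) * (l₁.length : ℝ) ^ 2 * ((1 + 12 / (((1 - 12 * |β₀|) * Real.log 108 / (2 * ((1300 + 4 * Real.sqrt 2) * |β₀| + (1 - 12 * |β₀|)))) / 2)) ^ 3 / (1 - Real.exp (-((((1 - 12 * |β₀|) * Real.log 108 / (2 * ((1300 + 4 * Real.sqrt 2) * |β₀| + (1 - 12 * |β₀|)))) / 2) / 2)))) ^ 2) := by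
    intro t ht
    have htabs : |t| ≤ |β₀| := abs_le.2 ⟨ht.1, ht.2⟩
    have ht12 : |t| < 1 / 12 := lt_of_le_of_lt htabs hβ₀
    rw [Real.norm_eq_abs]
    exact (abs_sum_sum_threePoint_le L t ht12 l₁ hl₁).trans (threePointConstant_mono htabs hβ₀ (by positivity))
  have hconv : Convex ℝ (Set.Icc (-|β₀|) |β₀|) := convex_Icc _ _
  have h0mem : (0 : ℝ) ∈ Set.Icc (-|β₀|) |β₀| := ⟨by simp [abs_nonneg], abs_nonneg _⟩
  have hbabs : |b| ≤ |β₀| := abs_le.2 ⟨hb.1, hb.2⟩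
  -- step 1: `|g t − g 0| ≤ K₀ |t|` on the window
  have hstep1 : ∀ t ∈ Set.Icc (-|β₀|) |β₀|, |(-((∫ x, (fun y : (Edge 3 L × Fin 2 × Fin 2 × Bool → ℝ) => ((l₁.map (fun a : Edge 3 L × Bool => if a.2 then ((fun (ee : Edge 3 L) => Matrix.of fun (i j : Fin 2) => ((y (ee, i, j, false) : ℝ) : ℂ) + ((y (ee, i, j, true) : ℝ) : ℂ) * Complex.I) a.1)ᴴ else (fun (ee : Edge 3 L) => Matrix.of fun (i j : Fin 2) => ((y (ee, i, j, false) : ℝ) : ℂ) + ((y (ee, i, j, true) : ℝ) : ℂ) * Complex.I) a.1)).prod).trace.re) (coords x) * Literature.MathematicalPhysics.QuantumFieldTheory.wilsonAction (fundamentalRep (Fin 2)) x ∂(wilsonMeasure (d := 3) (L := L) (fundamentalRep (Fin 2)) t)) - (∫ x, (fun y : (Edge 3 L × Fin 2 × Fin 2 × Bool → ℝ) => ((l₁.map (fun a : Edge 3 L × Bool => if a.2 then ((fun (ee : Edge 3 L) => Matrix.of fun (i j : Fin 2) => ((y (ee, i, j, false) : ℝ) : ℂ) + ((y (ee, i, j,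 true) : ℝ) : ℂ) * Complex.I) a.1)ᴴ else (fun (ee : Edge 3 L) => Matrix.of fun (i j : Fin 2) => ((y (ee, i, j, false) : ℝ) : ℂ) + ((y (ee, i, j, true) : ℝ) : ℂ) * Complex.I) a.1)).prod).trace.re) (coords x) ∂(wilsonMeasure (d := 3) (L := L) (fundamentalRep (Fin 2)) t)) * (∫ x, Literature.MathematicalPhysics.QuantumFieldTheory.wilsonAction (fundamentalRep (Fin 2)) x ∂(wilsonMeasure (d := 3) (L := L) (fundamentalRep (Fin 2)) t)))) - (-((∫ x, (fun y : (Edge 3 L × Fin 2 × Fin 2 × Bool → ℝ) => ((l₁.map (fun a : Edge 3 L × Bool => if a.2 then ((fun (ee : Edge 3 L) => Matrix.of fun (i j : Fin 2) => ((y (ee, i, j, false) : ℝ) : ℂ) + ((y (ee, i, j, true) : ℝ) : ℂ) * Complex.I) a.1)ᴴ else (fun (ee : Edge 3 L) => Matrix.of fun (i j : Fin 2) => ((y (ee, i, j, false) : ℝ) : ℂ) + ((y (ee, i, j, true) : ℝ) : ℂ) * Complex.I) a.1)).prod).trace.re) (coords x) * Literature.MathematicalPhysics.QuantumFieldTheory.wilsonAction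 (fundamentalRep (Fin 2)) x ∂(wilsonMeasure (d := 3) (L := L) (fundamentalRep (Fin 2)) 0)) - (∫ x, (fun y : (Edge 3 L × Fin 2 × Fin 2 × Bool → ℝ) => ((l₁.map (fun a : Edge 3 L × Bool => if a.2 then ((fun (ee : Edge 3 L) => Matrix.of fun (i j : Fin 2) => ((y (ee, i, j, false) : ℝ) : ℂ) + ((y (ee, i, j, true) : ℝ) : ℂ) * Complex.I) a.1)ᴴ else (fun (ee : Edge 3 L) => Matrix.of fun (i j : Fin 2) => ((y (ee, i, j, false) : ℝ) : ℂ) + ((y (ee, i, j, true) : ℝ) : ℂ) * Complex.I) a.1)).prod).trace.re) (coords x) ∂(wilsonMeasure (d := 3) (L := L) (fundamentalRep (Fin 2)) 0)) * (∫ x, Literature.MathematicalPhysics.QuantumFieldTheory.wilsonAction (fundamentalRep (Fin 2)) x ∂(wilsonMeasure (d := 3) (L := L) (fundamentalRep (Fin 2)) 0))))| ≤ (27 * (4096 * Real.pi ^ 2 * ((l₁.length : ℝ) ^ 2 + 8) * (2 / (1 - 12 * |β₀|)) * 108) * (l₁.length : ℝ) ^ 2 * ((1 + 12 / (((1 - 12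 * |β₀|) * Real.log 108 / (2 * ((1300 + 4 * Real.sqrt 2) * |β₀| + (1 - 12 * |β₀|)))) / 2)) ^ 3 / (1 - Real.exp (-((((1 - 12 * |β₀|) * Real.log 108 / (2 * ((1300 + 4 * Real.sqrt 2) * |β₀| + (1 - 12 * |β₀|)))) / 2) / 2)))) ^ 2) * |t| := by
    intro t ht
    have h := hconv.norm_image_sub_le_of_norm_hasDerivWithin_le hg hgb h0mem ht
    rw [Real.norm_eq_abs, Real.norm_eq_abs, sub_zero] at h
    exact h
  -- step 2: `h(t) = f(t) − t·g(0)` has derivative `g t − g 0`, bounded by `K₀|b|` on the segment `[0, b]`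
  have hsub : Set.uIcc 0 b ⊆ Set.Icc (-|β₀|) |β₀| := by
    intro t ht
    have htb : |t| ≤ |b| := by
      rcases Set.mem_uIcc.1 ht with ⟨h0t, htb⟩ | ⟨hbt, ht0⟩
      · rw [abs_of_nonneg h0t, abs_of_nonneg (h0t.trans htb)]; exact htb
      · rw [abs_of_nonpos ht0, abs_of_nonpos (hbt.trans ht0)]; linarith
    exact abs_le.1 (htb.trans hbabs)
  have hh : ∀ t ∈ Set.uIcc 0 b, HasDerivWithinAt (fun t : ℝ => (∫ x, (fun y : (Edge 3 L × Fin 2 × Fin 2 × Bool → ℝ) => ((l₁.map (fun a : Edge 3 L × Bool => if a.2 then ((fun (ee : Edge 3 L) => Matrix.of fun (i j : Fin 2) => ((y (ee, i, j, false) : ℝ) : ℂ) + ((y (ee, i, j, true) : ℝ) : ℂ) * Complex.I) a.1)ᴴ else (fun (ee : Edge 3 L) => Matrix.of fun (i j : Fin 2) => ((y (ee, i, j, false) : ℝ) : ℂ) + ((y (ee, i, j, true) : ℝ) : ℂ) * Complex.I) a.1)).prod).trace.re) (coords x) ∂(wilsonMeasure (d := 3) (L := L) (fundamentalRep (Fin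 2)) t)) - t * (-((∫ x, (fun y : (Edge 3 L × Fin 2 × Fin 2 × Bool → ℝ) => ((l₁.map (fun a : Edge 3 L × Bool => if a.2 then ((fun (ee : Edge 3 L) => Matrix.of fun (i j : Fin 2) => ((y (ee, i, j, false) : ℝ) : ℂ) + ((y (ee, i, j, true) : ℝ) : ℂ) * Complex.I) a.1)ᴴ else (fun (ee : Edge 3 L) => Matrix.of fun (i j : Fin 2) => ((y (ee, i, j, false) : ℝ) : ℂ) + ((y (ee, i, j, true) : ℝ) : ℂ) * Complex.I) a.1)).prod).trace.re) (coords x) * Literature.MathematicalPhysics.QuantumFieldTheory.wilsonAction (fundamentalRep (Fin 2)) x ∂(wilsonMeasure (d := 3) (L := L) (fundamentalRep (Fin 2)) 0)) - (∫ x, (fun y : (Edge 3 L × Fin 2 × Fin 2 × Bool → ℝ) => ((l₁.map (fun a : Edge 3 L × Bool => if a.2 then ((fun (ee : Edge 3 L) => Matrix.of fun (i j : Fin 2) => ((y (ee, i, j, false) : ℝ) : ℂ) + ((y (ee, i, j, true) : ℝ) : ℂ) * Complex.I) a.1)ᴴ else (fun (ee : Edge 3 L) => Matrix.of fun (i j :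 Fin 2) => ((y (ee, i, j, false) : ℝ) : ℂ) + ((y (ee, i, j, true) : ℝ) : ℂ) * Complex.I) a.1)).prod).trace.re) (coords x) ∂(wilsonMeasure (d := 3) (L := L) (fundamentalRep (Fin 2)) 0)) * (∫ x, Literature.MathematicalPhysics.QuantumFieldTheory.wilsonAction (fundamentalRep (Fin 2)) x ∂(wilsonMeasure (d := 3) (L := L) (fundamentalRep (Fin 2)) 0)))))
      ((-((∫ x, (fun y : (Edge 3 L × Fin 2 × Fin 2 × Bool → ℝ) => ((l₁.map (fun a : Edge 3 L × Bool => if a.2 then ((fun (ee : Edge 3 L) => Matrix.of fun (i j : Fin 2) => ((y (ee, i, j, false) : ℝ) : ℂ) + ((y (ee, i, j, true) : ℝ) : ℂ) * Complex.I) a.1)ᴴ else (fun (ee : Edge 3 L) => Matrix.of fun (i j : Fin 2) => ((y (ee, i, j, false) : ℝ) : ℂ) + ((y (ee, i, j, true) : ℝ) : ℂ) * Complex.I) a.1)).prod).trace.re) (coords x) * Literature.MathematicalPhysics.QuantumFieldTheory.wilsonAction (fundamentalRep (Fin 2)) x ∂(wilsonMeasure (d := 3) (L := L) (fundamentalRep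 (Fin 2)) t)) - (∫ x, (fun y : (Edge 3 L × Fin 2 × Fin 2 × Bool → ℝ) => ((l₁.map (fun a : Edge 3 L × Bool => if a.2 then ((fun (ee : Edge 3 L) => Matrix.of fun (i j : Fin 2) => ((y (ee, i, j, false) : ℝ) : ℂ) + ((y (ee, i, j, true) : ℝ) : ℂ) * Complex.I) a.1)ᴴ else (fun (ee : Edge 3 L) => Matrix.of fun (i j : Fin 2) => ((y (ee, i, j, false) : ℝ) : ℂ) + ((y (ee, i, j, true) : ℝ) : ℂ) * Complex.I) a.1)).prod).trace.re) (coords x) ∂(wilsonMeasure (d := 3) (L := L) (fundamentalRep (Fin 2)) t)) * (∫ x, Literature.MathematicalPhysics.QuantumFieldTheory.wilsonAction (fundamentalRep (Fin 2)) x ∂(wilsonMeasure (d := 3) (L := L) (fundamentalRep (Fin 2)) t)))) - 1 * (-((∫ x, (fun y : (Edge 3 L × Fin 2 × Fin 2 × Bool → ℝ) => ((l₁.map (fun a : Edge 3 L × Bool => if a.2 then ((fun (ee : Edge 3 L) => Matrix.of fun (i j : Fin 2) => ((y (ee, i, j, false) : ℝ) : ℂ) + ((y (ee, i, j, true) : ℝ)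 : ℂ) * Complex.I) a.1)ᴴ else (fun (ee : Edge 3 L) => Matrix.of fun (i j : Fin 2) => ((y (ee, i, j, false) : ℝ) : ℂ) + ((y (ee, i, j, true) : ℝ) : ℂ) * Complex.I) a.1)).prod).trace.re) (coords x) * Literature.MathematicalPhysics.QuantumFieldTheory.wilsonAction (fundamentalRep (Fin 2)) x ∂(wilsonMeasure (d := 3) (L := L) (fundamentalRep (Fin 2)) 0)) - (∫ x, (fun y : (Edge 3 L × Fin 2 × Fin 2 × Bool → ℝ) => ((l₁.map (fun a : Edge 3 L × Bool => if a.2 then ((fun (ee : Edge 3 L) => Matrix.of fun (i j : Fin 2) => ((y (ee, i, j, false) : ℝ) : ℂ) + ((y (ee, i, j, true) : ℝ) : ℂ) * Complex.I) a.1)ᴴ else (fun (ee : Edge 3 L) => Matrix.of fun (i j : Fin 2) => ((y (ee, i, j, false) : ℝ) : ℂ) + ((y (ee, i, j, true) : ℝ) : ℂ) * Complex.I) a.1)).prod).trace.re) (coords x) ∂(wilsonMeasure (d := 3) (L := L) (fundamentalRep (Fin 2)) 0)) * (∫ x, Literature.MathematicalPhysics.QuantumFieldTheory.wilsonAction (fundamentalRep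 (Fin 2)) x ∂(wilsonMeasure (d := 3) (L := L) (fundamentalRep (Fin 2)) 0))))) (Set.uIcc 0 b) t :=
    fun t _ => ((hasDerivAt_wilson_loop_expectation L t l₁).sub ((hasDerivAt_id t).mul_const _)).hasDerivWithinAt
  have hhb : ∀ t ∈ Set.uIcc 0 b, ‖(-((∫ x, (fun y : (Edge 3 L × Fin 2 × Fin 2 × Bool → ℝ) => ((l₁.map (fun a : Edge 3 L × Bool => if a.2 then ((fun (ee : Edge 3 L) => Matrix.of fun (i j : Fin 2) => ((y (ee, i, j, false) : ℝ) : ℂ) + ((y (ee, i, j, true) : ℝ) : ℂ) * Complex.I) a.1)ᴴ else (fun (ee : Edge 3 L) => Matrix.of fun (i j : Fin 2) => ((y (ee, i, j, false) : ℝ) : ℂ) + ((y (ee, i, j, true) : ℝ) : ℂ) * Complex.I) a.1)).prod).trace.re) (coords x) * Literature.MathematicalPhysics.QuantumFieldTheory.wilsonAction (fundamentalRep (Fin 2)) x ∂(wilsonMeasure (d := 3) (L := L) (fundamentalRep (Fin 2)) t)) - (∫ x, (fun y : (Edge 3 L × Fin 2 × Fin 2 × Bool → ℝ) => ((l₁.map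 (fun a : Edge 3 L × Bool => if a.2 then ((fun (ee : Edge 3 L) => Matrix.of fun (i j : Fin 2) => ((y (ee, i, j, false) : ℝ) : ℂ) + ((y (ee, i, j, true) : ℝ) : ℂ) * Complex.I) a.1)ᴴ else (fun (ee : Edge 3 L) => Matrix.of fun (i j : Fin 2) => ((y (ee, i, j, false) : ℝ) : ℂ) + ((y (ee, i, j, true) : ℝ) : ℂ) * Complex.I) a.1)).prod).trace.re) (coords x) ∂(wilsonMeasure (d := 3) (L := L) (fundamentalRep (Fin 2)) t)) * (∫ x, Literature.MathematicalPhysics.QuantumFieldTheory.wilsonAction (fundamentalRep (Fin 2)) x ∂(wilsonMeasure (d := 3) (L := L) (fundamentalRep (Fin 2)) t)))) - 1 * (-((∫ x, (fun y : (Edge 3 L × Fin 2 × Fin 2 × Bool → ℝ) => ((l₁.map (fun a : Edge 3 L × Bool => if a.2 then ((fun (ee : Edge 3 L) => Matrix.of fun (i j : Fin 2) => ((y (ee, i, j, false) : ℝ) : ℂ) + ((y (ee, i, j, true) : ℝ) : ℂ) * Complex.I) a.1)ᴴ else (fun (ee : Edge 3 L) => Matrix.of fun (i j : Fin 2) =>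 ((y (ee, i, j, false) : ℝ) : ℂ) + ((y (ee, i, j, true) : ℝ) : ℂ) * Complex.I) a.1)).prod).trace.re) (coords x) * Literature.MathematicalPhysics.QuantumFieldTheory.wilsonAction (fundamentalRep (Fin 2)) x ∂(wilsonMeasure (d := 3) (L := L) (fundamentalRep (Fin 2)) 0)) - (∫ x, (fun y : (Edge 3 L × Fin 2 × Fin 2 × Bool → ℝ) => ((l₁.map (fun a : Edge 3 L × Bool => if a.2 then ((fun (ee : Edge 3 L) => Matrix.of fun (i j : Fin 2) => ((y (ee, i, j, false) : ℝ) : ℂ) + ((y (ee, i, j, true) : ℝ) : ℂ) * Complex.I) a.1)ᴴ else (fun (ee : Edge 3 L) => Matrix.of fun (i j : Fin 2) => ((y (ee, i, j, false) : ℝ) : ℂ) + ((y (ee, i, j, true) : ℝ) : ℂ) * Complex.I) a.1)).prod).trace.re) (coords x) ∂(wilsonMeasure (d := 3) (L := L) (fundamentalRep (Fin 2)) 0)) * (∫ x, Literature.MathematicalPhysics.QuantumFieldTheory.wilsonAction (fundamentalRep (Fin 2)) x ∂(wilsonMeasure (d := 3) (L := L) (fundamentalRep (Fin 2)) 0))))‖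 ≤ (27 * (4096 * Real.pi ^ 2 * ((l₁.length : ℝ) ^ 2 + 8) * (2 / (1 - 12 * |β₀|)) * 108) * (l₁.length : ℝ) ^ 2 * ((1 + 12 / (((1 - 12 * |β₀|) * Real.log 108 / (2 * ((1300 + 4 * Real.sqrt 2) * |β₀| + (1 - 12 * |β₀|)))) / 2)) ^ 3 / (1 - Real.exp (-((((1 - 12 * |β₀|) * Real.log 108 / (2 * ((1300 + 4 * Real.sqrt 2) * |β₀| + (1 - 12 * |β₀|)))) / 2) / 2)))) ^ 2) * |b| := by
    intro t ht
    have htb : |t| ≤ |b| := by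
      rcases Set.mem_uIcc.1 ht with ⟨h0t, htb⟩ | ⟨hbt, ht0⟩
      · rw [abs_of_nonneg h0t, abs_of_nonneg (h0t.trans htb)]; exact htb
      · rw [abs_of_nonpos ht0, abs_of_nonpos (hbt.trans ht0)]; linarith
    rw [Real.norm_eq_abs, one_mul]
    exact (hstep1 t (hsub ht)).trans (mul_le_mul_of_nonneg_left htb hK0)
  have h := (convex_uIcc 0 b).norm_image_sub_le_of_norm_hasDerivWithin_le hh hhb Set.left_mem_uIcc Set.right_mem_uIcc
  rw [Real.norm_eq_abs, Real.norm_eq_abs, sub_zero, zero_mul, sub_zero] at h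
  have hb2 : |b| * |b| = b ^ 2 := by rw [abs_mul_abs_self]; ring
  calc |(∫ x, (fun y : (Edge 3 L × Fin 2 × Fin 2 × Bool → ℝ) => ((l₁.map (fun a : Edge 3 L × Bool => if a.2 then ((fun (ee : Edge 3 L) => Matrix.of fun (i j : Fin 2) => ((y (ee, i, j, false) : ℝ) : ℂ) + ((y (ee, i, j, true) : ℝ) : ℂ) * Complex.I) a.1)ᴴ else (fun (ee : Edge 3 L) => Matrix.of fun (i j : Fin 2) => ((y (ee, i, j, false) : ℝ) : ℂ) + ((y (ee, i, j, true) : ℝ) : ℂ) * Complex.I) a.1)).prod).trace.re) (coords x) ∂(wilsonMeasure (d := 3) (L := L) (fundamentalRep (Fin 2)) b)) - (∫ x, (fun y : (Edge 3 L × Fin 2 × Fin 2 × Bool → ℝ) => ((l₁.map (fun a : Edge 3 L × Bool => if a.2 then ((fun (ee : Edge 3 L) => Matrix.of fun (i j : Fin 2) => ((y (ee, i, j, false) : ℝ) : ℂ) + ((y (ee, i, j, true) : ℝ) : ℂ) * Complex.I) a.1)ᴴ else (fun (ee : Edge 3 L) => Matrix.of fun (i j : Fin 2) => ((y (ee, i,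 j, false) : ℝ) : ℂ) + ((y (ee, i, j, true) : ℝ) : ℂ) * Complex.I) a.1)).prod).trace.re) (coords x) ∂(wilsonMeasure (d := 3) (L := L) (fundamentalRep (Fin 2)) 0)) - b * (-((∫ x, (fun y : (Edge 3 L × Fin 2 × Fin 2 × Bool → ℝ) => ((l₁.map (fun a : Edge 3 L × Bool => if a.2 then ((fun (ee : Edge 3 L) => Matrix.of fun (i j : Fin 2) => ((y (ee, i, j, false) : ℝ) : ℂ) + ((y (ee, i, j, true) : ℝ) : ℂ) * Complex.I) a.1)ᴴ else (fun (ee : Edge 3 L) => Matrix.of fun (i j : Fin 2) => ((y (ee, i, j, false) : ℝ) : ℂ) + ((y (ee, i, j, true) : ℝ) : ℂ) * Complex.I) a.1)).prod).trace.re) (coords x) * Literature.MathematicalPhysics.QuantumFieldTheory.wilsonAction (fundamentalRep (Fin 2)) x ∂(wilsonMeasure (d := 3) (L := L) (fundamentalRep (Fin 2)) 0)) - (∫ x, (fun y : (Edge 3 L × Fin 2 × Fin 2 × Bool → ℝ) => ((l₁.map (fun a : Edge 3 L × Bool => if a.2 then ((fun (ee : Edge 3 L) => Matrix.of fun (i j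 : Fin 2) => ((y (ee, i, j, false) : ℝ) : ℂ) + ((y (ee, i, j, true) : ℝ) : ℂ) * Complex.I) a.1)ᴴ else (fun (ee : Edge 3 L) => Matrix.of fun (i j : Fin 2) => ((y (ee, i, j, false) : ℝ) : ℂ) + ((y (ee, i, j, true) : ℝ) : ℂ) * Complex.I) a.1)).prod).trace.re) (coords x) ∂(wilsonMeasure (d := 3) (L := L) (fundamentalRep (Fin 2)) 0)) * (∫ x, Literature.MathematicalPhysics.QuantumFieldTheory.wilsonAction (fundamentalRep (Fin 2)) x ∂(wilsonMeasure (d := 3) (L := L) (fundamentalRep (Fin 2)) 0))))|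
      = |(∫ x, (fun y : (Edge 3 L × Fin 2 × Fin 2 × Bool → ℝ) => ((l₁.map (fun a : Edge 3 L × Bool => if a.2 then ((fun (ee : Edge 3 L) => Matrix.of fun (i j : Fin 2) => ((y (ee, i, j, false) : ℝ) : ℂ) + ((y (ee, i, j, true) : ℝ) : ℂ) * Complex.I) a.1)ᴴ else (fun (ee : Edge 3 L) => Matrix.of fun (i j : Fin 2) => ((y (ee, i, j, false) : ℝ) : ℂ) + ((y (ee, i, j, true) : ℝ) : ℂ) * Complex.I) a.1)).prod).trace.re) (coords x) ∂(wilsonMeasure (d := 3) (L := L) (fundamentalRep (Fin 2)) b)) - b * (-((∫ x, (fun y : (Edge 3 L × Fin 2 × Fin 2 × Bool → ℝ) => ((l₁.map (fun a : Edge 3 L × Bool => if a.2 then ((fun (ee : Edge 3 L) => Matrix.of fun (i j : Fin 2) => ((y (ee, i, j, false) : ℝ) : ℂ) + ((y (ee, i, j, true) : ℝ) : ℂ) * Complex.I) a.1)ᴴ else (fun (ee : Edge 3 L) => Matrix.of fun (i j : Fin 2) => ((y (ee, i, j, false) : ℝ) : ℂ) + ((y (ee, i, j, true) : ℝ) : ℂ)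 * Complex.I) a.1)).prod).trace.re) (coords x) * Literature.MathematicalPhysics.QuantumFieldTheory.wilsonAction (fundamentalRep (Fin 2)) x ∂(wilsonMeasure (d := 3) (L := L) (fundamentalRep (Fin 2)) 0)) - (∫ x, (fun y : (Edge 3 L × Fin 2 × Fin 2 × Bool → ℝ) => ((l₁.map (fun a : Edge 3 L × Bool => if a.2 then ((fun (ee : Edge 3 L) => Matrix.of fun (i j : Fin 2) => ((y (ee, i, j, false) : ℝ) : ℂ) + ((y (ee, i, j, true) : ℝ) : ℂ) * Complex.I) a.1)ᴴ else (fun (ee : Edge 3 L) => Matrix.of fun (i j : Fin 2) => ((y (ee, i, j, false) : ℝ) : ℂ) + ((y (ee, i, j, true) : ℝ) : ℂ) * Complex.I) a.1)).prod).trace.re) (coords x) ∂(wilsonMeasure (d := 3) (L := L) (fundamentalRep (Fin 2)) 0)) * (∫ x, Literature.MathematicalPhysics.QuantumFieldTheory.wilsonAction (fundamentalRep (Fin 2)) x ∂(wilsonMeasure (d := 3) (L := L) (fundamentalRep (Fin 2)) 0)))) - (∫ x, (fun y : (Edge 3 L × Fin 2 × Fin 2 × Bool → ℝ) => ((l₁.map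 (fun a : Edge 3 L × Bool => if a.2 then ((fun (ee : Edge 3 L) => Matrix.of fun (i j : Fin 2) => ((y (ee, i, j, false) : ℝ) : ℂ) + ((y (ee, i, j, true) : ℝ) : ℂ) * Complex.I) a.1)ᴴ else (fun (ee : Edge 3 L) => Matrix.of fun (i j : Fin 2) => ((y (ee, i, j, false) : ℝ) : ℂ) + ((y (ee, i, j, true) : ℝ) : ℂ) * Complex.I) a.1)).prod).trace.re) (coords x) ∂(wilsonMeasure (d := 3) (L := L) (fundamentalRep (Fin 2)) 0))| := by rw [sub_right_comm]
    _ ≤ (27 * (4096 * Real.pi ^ 2 * ((l₁.length : ℝ) ^ 2 + 8) * (2 / (1 - 12 * |β₀|)) * 108) * (l₁.length : ℝ) ^ 2 * ((1 + 12 / (((1 - 12 * |β₀|) * Real.log 108 / (2 * ((1300 + 4 * Real.sqrt 2) * |β₀| + (1 - 12 * |β₀|)))) / 2)) ^ 3 / (1 - Real.exp (-((((1 - 12 * |β₀|) * Real.log 108 / (2 * ((1300 + 4 * Real.sqrt 2) * |β₀| + (1 - 12 * |β₀|)))) / 2) / 2)))) ^ 2) * |b| * |b| := h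
    _ = (27 * (4096 * Real.pi ^ 2 * ((l₁.length : ℝ) ^ 2 + 8) * (2 / (1 - 12 * |β₀|)) * 108) * (l₁.length : ℝ) ^ 2 * ((1 + 12 / (((1 - 12 * |β₀|) * Real.log 108 / (2 * ((1300 + 4 * Real.sqrt 2) * |β₀| + (1 - 12 * |β₀|)))) / 2)) ^ 3 / (1 - Real.exp (-((((1 - 12 * |β₀|) * Real.log 108 / (2 * ((1300 + 4 * Real.sqrt 2) * |β₀| + (1 - 12 * |β₀|)))) / 2) / 2)))) ^ 2) * b ^ 2 := by rw [mul_assoc, hb2]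

/-- ★★★ **THE STRONG-COUPLING EXPANSION OF THE PLAQUETTE TO SECOND ORDER, UNIFORMLY IN THE VOLUME**: for `|β₀| < 1/12`, every `L ≥ 2`, every
plaquette `p` and every `b ∈ [−|β₀|, |β₀|]`:
`|⟨Re tr U_p⟩_(μ_b) − b| ≤ 27·4096π²·24·(2/ρ₀)·108·16·((1+24/κ₀)³/(1−e^(−κ₀/4)))²·b²` — i.e. `⟨Re tr U_p⟩_b = b + O(b²)` with an error constant that
does NOT depend on `L` (`⟨Re tr U_p⟩_0 = 0`, file 26; slope `1`, file 28; second derivative bounded uniformly, file 32).  Fixed cut-off, strong-coupling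
window; nothing about `β'_K → ∞`; the Yang–Mills mass gap is NOT proved. [folklore; cite: Wilson1974, §III] -/
theorem plaquette_expectation_taylor_two (L : ℕ) [NeZero L] (hL : 1 < L) (β₀ : ℝ) (hβ₀ : |β₀| < 1 / 12) (p : Plaquette 3 L)
    {b : ℝ} (hb : b ∈ Set.Icc (-|β₀|) |β₀|) :
    |(∫ U, ((fundamentalRep (Fin 2) (plaquetteHolonomy U p.1 p.2.1.1 p.2.1.2) : Matrix (Fin 2) (Fin 2) ℂ)).trace.re ∂(wilsonMeasure (d := 3) (L := L) (fundamentalRep (Fin 2)) b)) - b| ≤ (27 * (4096 * Real.pi ^ 2 * ((4 : ℝ) ^ 2 + 8) * (2 / (1 - 12 * |β₀|)) * 108) * (4 : ℝ) ^ 2 * ((1 + 12 / (((1 - 12 * |β₀|) * Real.log 108 / (2 * ((1300 + 4 * Real.sqrt 2) * |β₀| + (1 - 12 * |β₀|)))) / 2)) ^ 3 / (1 - Real.exp (-((((1 - 12 * |β₀|) * Real.log 108 / (2 * ((1300 + 4 * Real.sqrt 2) * |β₀| + (1 - 12 * |β₀|)))) / 2) / 2)))) ^ 2) * b ^ 2 :=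 by
  classical
  have hij : p.2.1.1 ≠ p.2.1.2 := ne_of_lt p.2.2
  have hword : ∀ U : GaugeConfig 3 L (Matrix.specialUnitaryGroup (Fin 2) ℂ), (fun y : (Edge 3 L × Fin 2 × Fin 2 × Bool → ℝ) => (([((p.1, p.2.1.1), false), ((Literature.MathematicalPhysics.QuantumFieldTheory.Site.shift p.1 p.2.1.1, p.2.1.2), false), ((Literature.MathematicalPhysics.QuantumFieldTheory.Site.shift p.1 p.2.1.2, p.2.1.1), true), ((p.1, p.2.1.2), true)].map (fun a : Edge 3 L × Bool => if a.2 then ((fun (ee : Edge 3 L) => Matrix.of fun (i j : Fin 2) => ((y (ee, i, j, false) : ℝ) : ℂ) + ((y (ee, i, j, true) : ℝ) : ℂ) * Complex.I) a.1)ᴴ else (fun (ee : Edge 3 L) => Matrix.of fun (i j : Fin 2) => ((y (ee, i, j, false) : ℝ) : ℂ) + ((y (ee, i, j, true) : ℝ) : ℂ) * Complex.I) a.1)).prod).trace.re) (fun q : Edge 3 L × Fin 2 × Fin 2 × Bool => (fun z : ℂ => if q.2.2.2 then z.im else z.re) ((fundamentalRep (Fin 2) (U q.1) : Matrix (Fin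 2) (Fin 2) ℂ) q.2.1 q.2.2.1)) = ((fundamentalRep (Fin 2) (plaquetteHolonomy U p.1 p.2.1.1 p.2.1.2) : Matrix (Fin 2) (Fin 2) ℂ)).trace.re :=
    fun U => word_plaquette_eq U p.1 p.2.1.1 p.2.1.2
  have hfun : (fun b : ℝ => ∫ U, (fun y : (Edge 3 L × Fin 2 × Fin 2 × Bool → ℝ) => (([((p.1, p.2.1.1), false), ((Literature.MathematicalPhysics.QuantumFieldTheory.Site.shift p.1 p.2.1.1, p.2.1.2), false), ((Literature.MathematicalPhysics.QuantumFieldTheory.Site.shift p.1 p.2.1.2, p.2.1.1), true), ((p.1, p.2.1.2), true)].map (fun a : Edge 3 L × Bool => if a.2 then ((fun (ee : Edge 3 L) => Matrix.of fun (i j : Fin 2) => ((y (ee, i, j, false) : ℝ) : ℂ) + ((y (ee, i, j, true) : ℝ) : ℂ) * Complex.I) a.1)ᴴ else (fun (ee : Edge 3 L) => Matrix.of fun (i j : Fin 2) => ((y (ee, i, j, false) : ℝ) : ℂ) + ((y (ee, i, j, true) : ℝ) : ℂ) * Complex.I) a.1)).prod).trace.re) (fun q : Edge 3 L × Fin 2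 × Fin 2 × Bool => (fun z : ℂ => if q.2.2.2 then z.im else z.re) ((fundamentalRep (Fin 2) (U q.1) : Matrix (Fin 2) (Fin 2) ℂ) q.2.1 q.2.2.1)) ∂(wilsonMeasure (d := 3) (L := L) (fundamentalRep (Fin 2)) b)) =
      fun b : ℝ => ∫ U, ((fundamentalRep (Fin 2) (plaquetteHolonomy U p.1 p.2.1.1 p.2.1.2) : Matrix (Fin 2) (Fin 2) ℂ)).trace.re ∂(wilsonMeasure (d := 3) (L := L) (fundamentalRep (Fin 2)) b) := by
    funext b
    exact integral_congr_ae (ae_of_all _ hword)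
  -- slope: the covariance expression at `0` equals `1`
  have hD1 := hasDerivAt_wilson_loop_expectation L 0 [((p.1, p.2.1.1), false), ((Literature.MathematicalPhysics.QuantumFieldTheory.Site.shift p.1 p.2.1.1, p.2.1.2), false), ((Literature.MathematicalPhysics.QuantumFieldTheory.Site.shift p.1 p.2.1.2, p.2.1.1), true), ((p.1, p.2.1.2), true)]
  have hD2 := hasDerivAt_plaquette_expectation_zero L hL p
  have hslope : (-((∫ x, (fun y : (Edge 3 L × Fin 2 × Fin 2 × Bool → ℝ) => (([((p.1, p.2.1.1), false), ((Literature.MathematicalPhysics.QuantumFieldTheory.Site.shift p.1 p.2.1.1, p.2.1.2), false), ((Literature.MathematicalPhysics.QuantumFieldTheory.Site.shift p.1 p.2.1.2, p.2.1.1), true), ((p.1, p.2.1.2), true)].map (fun a : Edge 3 L × Bool => if a.2 then ((fun (ee : Edge 3 L) => Matrix.of fun (i j : Fin 2) => ((y (ee, i, j, false) : ℝ) : ℂ) + ((y (ee, i, j, true) : ℝ) : ℂ) * Complex.I) a.1)ᴴ else (fun (ee : Edge 3 L) => Matrix.of fun (i j : Fin 2) => ((y (ee, i, j, false) : ℝ)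 : ℂ) + ((y (ee, i, j, true) : ℝ) : ℂ) * Complex.I) a.1)).prod).trace.re) (fun q : Edge 3 L × Fin 2 × Fin 2 × Bool => (fun z : ℂ => if q.2.2.2 then z.im else z.re) ((fundamentalRep (Fin 2) (x q.1) : Matrix (Fin 2) (Fin 2) ℂ) q.2.1 q.2.2.1)) * Literature.MathematicalPhysics.QuantumFieldTheory.wilsonAction (fundamentalRep (Fin 2)) x ∂(wilsonMeasure (d := 3) (L := L) (fundamentalRep (Fin 2)) 0)) -
      (∫ x, (fun y : (Edge 3 L × Fin 2 × Fin 2 × Bool → ℝ) => (([((p.1, p.2.1.1), false), ((Literature.MathematicalPhysics.QuantumFieldTheory.Site.shift p.1 p.2.1.1, p.2.1.2), false), ((Literature.MathematicalPhysics.QuantumFieldTheory.Site.shift p.1 p.2.1.2, p.2.1.1), true), ((p.1, p.2.1.2), true)].map (fun a : Edge 3 L × Bool => if a.2 then ((fun (ee : Edge 3 L) => Matrix.of fun (i j : Fin 2) => ((y (ee, i, j, false) : ℝ) : ℂ) + ((y (ee, i, j, true) : ℝ) : ℂ) * Complex.I) a.1)ᴴ else (fun (ee : Edge 3 L) => Matrix.of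 fun (i j : Fin 2) => ((y (ee, i, j, false) : ℝ) : ℂ) + ((y (ee, i, j, true) : ℝ) : ℂ) * Complex.I) a.1)).prod).trace.re) (fun q : Edge 3 L × Fin 2 × Fin 2 × Bool => (fun z : ℂ => if q.2.2.2 then z.im else z.re) ((fundamentalRep (Fin 2) (x q.1) : Matrix (Fin 2) (Fin 2) ℂ) q.2.1 q.2.2.1)) ∂(wilsonMeasure (d := 3) (L := L) (fundamentalRep (Fin 2)) 0)) * (∫ x, Literature.MathematicalPhysics.QuantumFieldTheory.wilsonAction (fundamentalRep (Fin 2)) x ∂(wilsonMeasure (d := 3) (L := L) (fundamentalRep (Fin 2)) 0)))) = 1 := by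
    have hD1' : HasDerivAt (fun b : ℝ => ∫ U, ((fundamentalRep (Fin 2) (plaquetteHolonomy U p.1 p.2.1.1 p.2.1.2) : Matrix (Fin 2) (Fin 2) ℂ)).trace.re ∂(wilsonMeasure (d := 3) (L := L) (fundamentalRep (Fin 2)) b)) (-((∫ x, (fun y : (Edge 3 L × Fin 2 × Fin 2 × Bool → ℝ) => (([((p.1, p.2.1.1), false), ((Literature.MathematicalPhysics.QuantumFieldTheory.Site.shift p.1 p.2.1.1, p.2.1.2), false), ((Literature.MathematicalPhysics.QuantumFieldTheory.Site.shift p.1 p.2.1.2, p.2.1.1), true), ((p.1, p.2.1.2), true)].map (fun a : Edge 3 L × Bool => if a.2 then ((fun (ee : Edge 3 L) => Matrix.of fun (i j : Fin 2) => ((y (ee, i, j, false) : ℝ) : ℂ) + ((y (ee, i, j, true) : ℝ) : ℂ) * Complex.I) a.1)ᴴ else (fun (ee : Edge 3 L) => Matrix.of fun (i j : Fin 2) => ((y (ee, i, j, false) : ℝ) : ℂ) + ((y (ee, i, j, true) : ℝ) : ℂ) * Complex.I) a.1)).prod).trace.re) (fun q : Edge 3 L × Fin 2 × Fin 2 ×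 Bool => (fun z : ℂ => if q.2.2.2 then z.im else z.re) ((fundamentalRep (Fin 2) (x q.1) : Matrix (Fin 2) (Fin 2) ℂ) q.2.1 q.2.2.1)) * Literature.MathematicalPhysics.QuantumFieldTheory.wilsonAction (fundamentalRep (Fin 2)) x ∂(wilsonMeasure (d := 3) (L := L) (fundamentalRep (Fin 2)) 0)) -
      (∫ x, (fun y : (Edge 3 L × Fin 2 × Fin 2 × Bool → ℝ) => (([((p.1, p.2.1.1), false), ((Literature.MathematicalPhysics.QuantumFieldTheory.Site.shift p.1 p.2.1.1, p.2.1.2), false), ((Literature.MathematicalPhysics.QuantumFieldTheory.Site.shift p.1 p.2.1.2, p.2.1.1), true), ((p.1, p.2.1.2), true)].map (fun a : Edge 3 L × Bool => if a.2 then ((fun (ee : Edge 3 L) => Matrix.of fun (i j : Fin 2) => ((y (ee, i, j, false) : ℝ) : ℂ) + ((y (ee, i, j, true) : ℝ) : ℂ) * Complex.I) a.1)ᴴ else (fun (ee : Edge 3 L) => Matrix.of fun (i j : Fin 2) => ((y (ee, i, j, false) : ℝ) : ℂ) + ((y (ee, i, j, true) : ℝ) : ℂ) * Complex.I) a.1)).prod).trace.re)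 (fun q : Edge 3 L × Fin 2 × Fin 2 × Bool => (fun z : ℂ => if q.2.2.2 then z.im else z.re) ((fundamentalRep (Fin 2) (x q.1) : Matrix (Fin 2) (Fin 2) ℂ) q.2.1 q.2.2.1)) ∂(wilsonMeasure (d := 3) (L := L) (fundamentalRep (Fin 2)) 0)) * (∫ x, Literature.MathematicalPhysics.QuantumFieldTheory.wilsonAction (fundamentalRep (Fin 2)) x ∂(wilsonMeasure (d := 3) (L := L) (fundamentalRep (Fin 2)) 0)))) 0 := by
      rw [← hfun]; exact hD1
    exact hD1'.unique hD2
  -- value at `0`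
  have h0 : (∫ x, (fun y : (Edge 3 L × Fin 2 × Fin 2 × Bool → ℝ) => (([((p.1, p.2.1.1), false), ((Literature.MathematicalPhysics.QuantumFieldTheory.Site.shift p.1 p.2.1.1, p.2.1.2), false), ((Literature.MathematicalPhysics.QuantumFieldTheory.Site.shift p.1 p.2.1.2, p.2.1.1), true), ((p.1, p.2.1.2), true)].map (fun a : Edge 3 L × Bool => if a.2 then ((fun (ee : Edge 3 L) => Matrix.of fun (i j : Fin 2) => ((y (ee, i, j, false) : ℝ) : ℂ) + ((y (ee, i, j, true) : ℝ) : ℂ) * Complex.I) a.1)ᴴ else (fun (ee : Edge 3 L) => Matrix.of fun (i j : Fin 2) => ((y (ee, i, j, false) : ℝ) : ℂ) + ((y (ee, i, j, true) : ℝ) : ℂ) * Complex.I) a.1)).prod).trace.re) (fun q : Edge 3 L × Fin 2 × Fin 2 × Bool => (fun z : ℂ => if q.2.2.2 then z.im else z.re) ((fundamentalRep (Fin 2) (x q.1) : Matrix (Fin 2) (Fin 2) ℂ) q.2.1 q.2.2.1)) ∂(wilsonMeasure (d := 3) (L := L) (fundamentalRep (Fin 2)) 0)) = 0 := by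
    rw [integral_congr_ae (ae_of_all _ hword), wilsonMeasure_zero_eq_pi L, integral_plaquette_pi_eq_zero L hL p.1 hij]
  have hmain : |(∫ x, (fun y : (Edge 3 L × Fin 2 × Fin 2 × Bool → ℝ) => (([((p.1, p.2.1.1), false), ((Literature.MathematicalPhysics.QuantumFieldTheory.Site.shift p.1 p.2.1.1, p.2.1.2), false), ((Literature.MathematicalPhysics.QuantumFieldTheory.Site.shift p.1 p.2.1.2, p.2.1.1), true), ((p.1, p.2.1.2), true)].map (fun a : Edge 3 L × Bool => if a.2 then ((fun (ee : Edge 3 L) => Matrix.of fun (i j : Fin 2) => ((y (ee, i, j, false) : ℝ) : ℂ) + ((y (ee, i, j, true) : ℝ) : ℂ) * Complex.I) a.1)ᴴ else (fun (ee : Edge 3 L) => Matrix.of fun (i j : Fin 2) => ((y (ee, i, j, false) : ℝ) : ℂ) + ((y (ee, i, j, true) : ℝ) : ℂ) * Complex.I) a.1)).prod).trace.re) (fun q : Edge 3 L × Fin 2 × Fin 2 × Bool => (fun z : ℂ => if q.2.2.2 then z.im else z.re) ((fundamentalRep (Fin 2) (x q.1) : Matrix (Fin 2) (Fin 2) ℂ)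 q.2.1 q.2.2.1)) ∂(wilsonMeasure (d := 3) (L := L) (fundamentalRep (Fin 2)) b)) -
      (∫ x, (fun y : (Edge 3 L × Fin 2 × Fin 2 × Bool → ℝ) => (([((p.1, p.2.1.1), false), ((Literature.MathematicalPhysics.QuantumFieldTheory.Site.shift p.1 p.2.1.1, p.2.1.2), false), ((Literature.MathematicalPhysics.QuantumFieldTheory.Site.shift p.1 p.2.1.2, p.2.1.1), true), ((p.1, p.2.1.2), true)].map (fun a : Edge 3 L × Bool => if a.2 then ((fun (ee : Edge 3 L) => Matrix.of fun (i j : Fin 2) => ((y (ee, i, j, false) : ℝ) : ℂ) + ((y (ee, i, j, true) : ℝ) : ℂ) * Complex.I) a.1)ᴴ else (fun (ee : Edge 3 L) => Matrix.of fun (i j : Fin 2) => ((y (ee, i, j, false) : ℝ) : ℂ) + ((y (ee, i, j, true) : ℝ) : ℂ) * Complex.I) a.1)).prod).trace.re) (fun q : Edge 3 L × Fin 2 × Fin 2 × Bool => (fun z : ℂ => if q.2.2.2 then z.im else z.re) ((fundamentalRep (Fin 2) (x q.1) : Matrix (Fin 2) (Fin 2) ℂ) q.2.1 q.2.2.1))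 ∂(wilsonMeasure (d := 3) (L := L) (fundamentalRep (Fin 2)) 0)) -
      b * (-((∫ x, (fun y : (Edge 3 L × Fin 2 × Fin 2 × Bool → ℝ) => (([((p.1, p.2.1.1), false), ((Literature.MathematicalPhysics.QuantumFieldTheory.Site.shift p.1 p.2.1.1, p.2.1.2), false), ((Literature.MathematicalPhysics.QuantumFieldTheory.Site.shift p.1 p.2.1.2, p.2.1.1), true), ((p.1, p.2.1.2), true)].map (fun a : Edge 3 L × Bool => if a.2 then ((fun (ee : Edge 3 L) => Matrix.of fun (i j : Fin 2) => ((y (ee, i, j, false) : ℝ) : ℂ) + ((y (ee, i, j, true) : ℝ) : ℂ) * Complex.I) a.1)ᴴ else (fun (ee : Edge 3 L) => Matrix.of fun (i j : Fin 2) => ((y (ee, i, j, false) : ℝ) : ℂ) + ((y (ee, i, j, true) : ℝ) : ℂ) * Complex.I) a.1)).prod).trace.re) (fun q : Edge 3 L × Fin 2 × Fin 2 × Bool => (fun z : ℂ => if q.2.2.2 then z.im else z.re) ((fundamentalRep (Fin 2) (x q.1) : Matrix (Fin 2) (Fin 2) ℂ) q.2.1 q.2.2.1)) * Literature.MathematicalPhysics.QuantumFieldTheory.wilsonAction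 (fundamentalRep (Fin 2)) x ∂(wilsonMeasure (d := 3) (L := L) (fundamentalRep (Fin 2)) 0)) -
      (∫ x, (fun y : (Edge 3 L × Fin 2 × Fin 2 × Bool → ℝ) => (([((p.1, p.2.1.1), false), ((Literature.MathematicalPhysics.QuantumFieldTheory.Site.shift p.1 p.2.1.1, p.2.1.2), false), ((Literature.MathematicalPhysics.QuantumFieldTheory.Site.shift p.1 p.2.1.2, p.2.1.1), true), ((p.1, p.2.1.2), true)].map (fun a : Edge 3 L × Bool => if a.2 then ((fun (ee : Edge 3 L) => Matrix.of fun (i j : Fin 2) => ((y (ee, i, j, false) : ℝ) : ℂ) + ((y (ee, i, j, true) : ℝ) : ℂ) * Complex.I) a.1)ᴴ else (fun (ee : Edge 3 L) => Matrix.of fun (i j : Fin 2) => ((y (ee, i, j, false) : ℝ) : ℂ) + ((y (ee, i, j, true) : ℝ) : ℂ) * Complex.I) a.1)).prod).trace.re) (fun q : Edge 3 L × Fin 2 × Fin 2 × Bool => (fun z : ℂ => if q.2.2.2 then z.im else z.re) ((fundamentalRep (Fin 2) (x q.1) : Matrix (Fin 2) (Fin 2) ℂ) q.2.1 q.2.2.1))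 ∂(wilsonMeasure (d := 3) (L := L) (fundamentalRep (Fin 2)) 0)) * (∫ x, Literature.MathematicalPhysics.QuantumFieldTheory.wilsonAction (fundamentalRep (Fin 2)) x ∂(wilsonMeasure (d := 3) (L := L) (fundamentalRep (Fin 2)) 0))))| ≤
      (27 * (4096 * Real.pi ^ 2 * ((([((p.1, p.2.1.1), false), ((Literature.MathematicalPhysics.QuantumFieldTheory.Site.shift p.1 p.2.1.1, p.2.1.2), false), ((Literature.MathematicalPhysics.QuantumFieldTheory.Site.shift p.1 p.2.1.2, p.2.1.1), true), ((p.1, p.2.1.2), true)] : List (Edge 3 L × Bool)).length : ℝ) ^ 2 + 8) * (2 / (1 - 12 * |β₀|)) * 108) * (([((p.1, p.2.1.1), false), ((Literature.MathematicalPhysics.QuantumFieldTheory.Site.shift p.1 p.2.1.1, p.2.1.2), false), ((Literature.MathematicalPhysics.QuantumFieldTheory.Site.shift p.1 p.2.1.2, p.2.1.1), true), ((p.1, p.2.1.2), true)] : List (Edge 3 L × Bool)).length : ℝ) ^ 2 * ((1 + 12 / (((1 - 12 * |β₀|) * Real.log 108 / (2 * ((1300 + 4 * Real.sqrt 2) *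 |β₀| + (1 - 12 * |β₀|)))) / 2)) ^ 3 / (1 - Real.exp (-((((1 - 12 * |β₀|) * Real.log 108 / (2 * ((1300 + 4 * Real.sqrt 2) * |β₀| + (1 - 12 * |β₀|)))) / 2) / 2)))) ^ 2) * b ^ 2 :=
    wilson_loop_expectation_taylor_two L β₀ hβ₀ [((p.1, p.2.1.1), false), ((Literature.MathematicalPhysics.QuantumFieldTheory.Site.shift p.1 p.2.1.1, p.2.1.2), false), ((Literature.MathematicalPhysics.QuantumFieldTheory.Site.shift p.1 p.2.1.2, p.2.1.1), true), ((p.1, p.2.1.2), true)] (List.cons_ne_nil _ _) hb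
  have hlen : (([((p.1, p.2.1.1), false), ((Literature.MathematicalPhysics.QuantumFieldTheory.Site.shift p.1 p.2.1.1, p.2.1.2), false), ((Literature.MathematicalPhysics.QuantumFieldTheory.Site.shift p.1 p.2.1.2, p.2.1.1), true), ((p.1, p.2.1.2), true)] : List (Edge 3 L × Bool)).length : ℝ) = 4 := by norm_num
  rw [hslope, h0, hlen, integral_congr_ae (ae_of_all _ hword), sub_zero, mul_one] at hmain
  exact hmain

end Summit.QuantumFields.YangMills.Theorems.ColdStartUniversality.LiebRobinson
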